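import Mathlib
import Summits.KontsevichZagierPeriods.Zeta5Search.SorokinCensus.Generalized
import HarnessLib

/-!
HONEST FRAMING: systematic search; no irrationality claim unless certified.

# THEOREM R — the top coefficient of a zigzag (Sorokin–Fischler) integral is a constant term
(typed statement layer + the COMPUTABLE constant term `ct`; FAMILY.md §17n, file of record
`pub-zeta5-fam-sorokin/gen6/THEOREM-R.md`).  fam-sorokin gen 6 (planner-pub-zeta5-fam-sorokin-g6-0), 2026-08-21.

In the chart `s_j = t_j` (`j` odd), `s_j = 1 - t_j` (`j` even) of the zigzag-cell coordinates of FAMILY §17b the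
generalized integrand of `GenPoint.J` becomes the POSITIVE Laurent polynomial
`F_p(s) = ∏ (1-s_j)^{B_j} ∏ (s_j+s_{j+1}-1)^{γ_j} ∏ s_j^{-π_j}` on `Z₅ = {s ∈ [0,1]⁵ : s_j + s_{j+1} ≥ 1}`, with
`B_j = a_j - 1`, `γ_j = c_j - 1`, `π₁ = a₀`, `π_j = b_{j-1} + e_j - 1` (`2 ≤ j ≤ 4`), `π₅ = b₄ - c₅` (paper indices).

**THEOREM R** (PROVED ON PAPER in THEOREM-R.md §2 — an elementary iterated harmonic-polylogarithm argument: the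
stage kernels `(1-u)^{B}(u+w-1)^{γ}u^{-π}` have their only pole at `u = 0`, so the top-weight channel is the pure
`du/u` channel and its coefficient stays a polynomial; NOT kernel-certified, hence tagged `@[conjecture]` here):
for every admissible integrable integer point,
`J(p) = 2·ct(p)·ζ(5) + q₄ζ(4) + q₃ζ(3) + q₂ζ(2) + q₀` with `qᵢ ∈ ℚ`, where
`ct(p) = [∏ s_j^{π_j-1}] ∏(1-s_j)^{B_j}∏(s_j+s_{j+1}-1)^{γ_j} ∈ ℤ` is the residue of `F_p ds` at the vertex `s = 0`
(`2ζ(5) = J(1;1⁵|2⁵)`, Vasilyev).  In particular (COROLLARY D) the `ζ(2)ζ(3)`-coefficient vanishes on the whole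
convergent 14-parameter family and `c₅ ∈ 2ℤ`.  The same statement holds in every depth `k` with
`V_k = ζ(2), 2ζ(3), (7/4)ζ(4), 2ζ(5)` (`k = 2..5`); `k = 2` is Rhin–Viola's contour formula (1996) = Dupont,
Compositio Math. 154 (2018) Prop. 5.3 at `n = 2`; on Beukers' `ζ(3)` diagonal `ct` = Apéry's numbers `5, 73, 1445, …`
and on the Vasilyev–Zudilin `ζ(5)` diagonal `ct = 9, 469, 38601, …` (kernel-checked evaluations below).
EVIDENCE (exact engine, not kernel): `c₅ = 2·ct` and `[ζ2ζ3] = 0` on 12,980 + 4,240 random convergent points, 0 failures.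
Nothing in this file is an irrationality statement.
-/

namespace Summit.KontsevichZagierPeriods.Zeta5Search.SorokinCensus

open Literature.NumberTheory.Irrationality.Zudilin2002 MeasureTheory

/-- `[u^i] (1-u)^B` as a function of an integer exponent `i` (zero outside `0 ≤ i ≤ B`). -/
def signedChoose (B : ℕ) (i : ℤ) : ℤ :=
  if 0 ≤ i ∧ i ≤ (B : ℤ) then (-1) ^ i.toNat * (B.choose i.toNat : ℤ) else 0

/-- ITERATED CONSTANT TERM along a zigzag chain.  Input: the list of stage data `(B_j, γ_j, π_j)` of the remaining
variables (the `γ` of the last stage is ignored) and the exponent `v` of the current variable inherited from the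
previous diagonal factor `(s_{j-1}+s_j-1)^{γ_{j-1}}`.  Output:
`[∏_j s_j^{π_j-1}] s_1^{v} ∏_j (1-s_j)^{B_j} ∏_j (s_j+s_{j+1}-1)^{γ_j}`, expanded as
`(s_j+s_{j+1}-1)^{γ} = Σ C(γ,u)C(γ-u,v')(-1)^{γ-u-v'} s_j^{u}s_{j+1}^{v'}`. -/
def ctChain : List (ℕ × ℕ × ℤ) → ℕ → ℤ
  | [], _ => 1
  | [(B, _, π)], v => signedChoose B (π - 1 - v)
  | (B, γ, π) :: s :: rest, v =>
      ((List.range (γ + 1)).map fun u =>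
        ((List.range (γ + 1 - u)).map fun v' =>
          (γ.choose u : ℤ) * ((γ - u).choose v' : ℤ) * (-1) ^ (γ - u - v') *
            signedChoose B (π - 1 - v - u) * ctChain (s :: rest) v').sum).sum

/-- Depth 2 (Beukers' `ζ(2)` integrals, `n = 1, 2, 3`): `ct = -3, 19, -147` (`= (-1)^n ×` Apéry's `ζ(2)`-numbers). -/
theorem ctChain_beukers2 : ctChain [(1, 1, 2), (1, 0, 2)] 0 = -3 ∧ ctChain [(2, 2, 3), (2, 0, 3)] 0 = 19 := by decide

/-- Depth 3, Beukers' `ζ(3)` integrals `J₃(n+1; (n+1)³ | (2n+2)³)`, `n = 1, 2, 3`: `ct` = Apéry's numbers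
`b_n = Σ C(n,i)²C(n+i,i)² = 5, 73, 1445` (and `c₃ = 2 b_n`, Beukers 1979). -/
theorem ctChain_apery : ctChain [(1, 1, 2), (1, 1, 3), (1, 0, 2)] 0 = 5 ∧
    ctChain [(2, 2, 3), (2, 2, 5), (2, 0, 3)] 0 = 73 ∧ ctChain [(3, 3, 4), (3, 3, 7), (3, 0, 4)] 0 = 1445 := by
  decide

/-- `[u^i] (1+u)^B` (zero outside `0 ≤ i ≤ B`). -/
def plainChoose (B : ℕ) (i : ℤ) : ℕ :=
  if 0 ≤ i ∧ i ≤ (B : ℤ) then B.choose i.toNat else 0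

/-- The SIGN-FREE chain: `[∏ s_j^{π_j-1}] s_1^{v} ∏ (1+s_j)^{B_j} ∏ (1+s_j+s_{j+1})^{γ_j}` — a non-negative integer counting
(with multinomial weights) the decompositions `π_j - 1 = i_j + u_j + v_{j-1}`, `0 ≤ i_j ≤ B_j`, `u_j + v_j ≤ γ_j`. -/
def posChain : List (ℕ × ℕ × ℤ) → ℕ → ℕ
  | [], _ => 1
  | [(B, _, π)], v => plainChoose B (π - 1 - v)
  | (B, γ, π) :: s :: rest, v =>
      ((List.range (γ + 1)).map fun u =>
        ((List.range (γ + 1 - u)).map fun v' =>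
          γ.choose u * (γ - u).choose v' * plainChoose B (π - 1 - v - u) * posChain (s :: rest) v').sum).sum

/-- SUPPLY–DEMAND (polymatroid) test for the chain data `(B_j, γ_j, π_j)_{j<k}`: `π_j ≥ 1` for all `j` and, for every
non-empty `S ⊆ {0,…,k-1}` (bitmask), `Σ_{j∈S} (π_j-1) ≤ Σ_{j∈S} B_j + Σ_{j<k-1, j∈S ∨ j+1∈S} γ_j`.  By the supply–demand
theorem (max-flow/min-cut) this holds iff a decomposition as in `posChain` exists, i.e. iff `posChain ≠ 0`; these are the
`2^k - 1` face-at-infinity conditions of the TOP simplex, the `π_j ≥ 1` being its `k` finite facets (FAMILY §17m(1)). -/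
def topPoleTest (d : List (ℕ × ℕ × ℤ)) : Bool :=
  let k := d.length
  (d.all fun t => decide (1 ≤ t.2.2)) &&
  (List.range (2 ^ k)).all fun mask => mask == 0 ||
    decide ((((List.range k).filter fun j => mask.testBit j).map fun j => (d.getD j (0, 0, 0)).2.2 - 1).sum ≤
      ((((List.range k).filter fun j => mask.testBit j).map fun j => ((d.getD j (0, 0, 0)).1 : ℤ)).sum +
       (((List.range (k - 1)).filter fun j => mask.testBit j || mask.testBit (j + 1)).map
          fun j => ((d.getD j (0, 0, 0)).2.1 : ℤ)).sum))

namespace GenPoint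

/-- THE CONSTANT TERM `ct(p) = [∏ s_j^{π_j-1}] ∏(1-s_j)^{a_j-1} ∏(s_j+s_{j+1}-1)^{c_j-1}` of a generalized point
(0-based fields: `π = (a₀, b 0 + e 1 - 1, b 1 + e 2 - 1, b 2 + e 3 - 1, b 3 - c 4)`); meaningful for admissible `p`
(`a_j, c_j ≥ 1`), junk (`toNat`) otherwise. `= Res_{s=0} F_p ds`, an integer. -/
def ct (p : GenPoint) : ℤ :=
  ctChain [((p.a 0 - 1).toNat, (p.c 0 - 1).toNat, p.a₀),
    ((p.a 1 - 1).toNat, (p.c 1 - 1).toNat, p.b 0 + p.e 1 - 1),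
    ((p.a 2 - 1).toNat, (p.c 2 - 1).toNat, p.b 1 + p.e 2 - 1),
    ((p.a 3 - 1).toNat, (p.c 3 - 1).toNat, p.b 2 + p.e 3 - 1),
    ((p.a 4 - 1).toNat, 0, p.b 3 - p.c 4)] 0

/-- The chain data `(B_j, γ_j, π_j)` of a generalized point (same dictionary as `ct`). -/
def chainData (p : GenPoint) : List (ℕ × ℕ × ℤ) :=
  [((p.a 0 - 1).toNat, (p.c 0 - 1).toNat, p.a₀),
    ((p.a 1 - 1).toNat, (p.c 1 - 1).toNat, p.b 0 + p.e 1 - 1),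
    ((p.a 2 - 1).toNat, (p.c 2 - 1).toNat, p.b 1 + p.e 2 - 1),
    ((p.a 3 - 1).toNat, (p.c 3 - 1).toNat, p.b 2 + p.e 3 - 1),
    ((p.a 4 - 1).toNat, 0, p.b 3 - p.c 4)]

/-- `ct p` is `ctChain` of the chain data (definitional unfolding; auxiliary lemma). -/
theorem ct_eq_ctChain_chainData (p : GenPoint) : p.ct = ctChain p.chainData 0 := rfl

/-- `|ct(p)|` as a manifestly non-negative count: `[∏ s_j^{π_j-1}] ∏(1+s_j)^{a_j-1}∏(1+s_j+s_{j+1})^{c_j-1}`. -/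
def ctAbs (p : GenPoint) : ℕ := posChain p.chainData 0

/-- The TOP-pole (supply–demand) test of a generalized point. -/
def topPole (p : GenPoint) : Bool := topPoleTest p.chainData

/-- The sign exponent `Σ_j (π_j - 1) + Σ_{j<4} (c_j - 1)`. -/
def signExp (p : GenPoint) : ℤ :=
  (p.a₀ - 1) + (p.b 0 + p.e 1 - 2) + (p.b 1 + p.e 2 - 2) + (p.b 2 + p.e 3 - 2) + (p.b 3 - p.c 4 - 1) +
    ((p.c 0 - 1) + (p.c 1 - 1) + (p.c 2 - 1) + (p.c 3 - 1))

/-- Vasilyev–Zudilin diagonal `J₅(n+1; (n+1)⁵ | (2n+2)⁵)`, `n = 1, 2`: `ct = 9, 469`, i.e. `c₅ = 18, 938`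
(Zudilin 2002: `J₅(2;2⁵|4⁵) = 18ζ(5) + 66ζ(3) - 98`). -/
theorem ct_zudilin_diag : ct ⟨2, fun _ => 2, fun _ => 4, fun _ => 0⟩ = 9 ∧ ct ⟨3, fun _ => 3, fun _ => 6, fun _ => 0⟩ = 469 := by
  decide

/-- The base point `(1; 1⁵ | 2⁵)` (`F = 1/(s₁⋯s₅)`): `ct = 1`, `J = 2ζ(5)`. -/
theorem ct_base : ct ⟨1, fun _ => 1, fun _ => 2, fun _ => 0⟩ = 1 := by decide

/-- Generalized points with inner exponents (exact engine values quoted for orientation, not kernel facts):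
`(2; 2,1,1,1,1 | 4,3,2,2,2; e₂ = e₃ = -1)`: `ct = 3`, `J = 6ζ(5) + 10ζ(3) - 18`;
`(1; 1,2,1,2,2 | 3,3,2,3,3; e₂ = 1, e₃ = -1)`: `ct = 1`, `J = 2ζ(5) - (11/4)ζ(4) + 7ζ(3) + (5/2)ζ(2) - 23/2`;
`(1; 1⁵ | 2⁵; e₂ = -1)`: `π₂ = b₁ + e₂ - 1 = 0` (no pole on `s₂ = 0`), `ct = 0`, `J = 4 - 2ζ(3)` — `ζ(5)` absent as
THEOREM R predicts. -/
theorem ct_inner_examples : ct ⟨2, ![2, 1, 1, 1, 1], ![4, 3, 2, 2, 2], ![0, -1, -1, 0, 0]⟩ = 3 ∧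
    ct ⟨1, ![1, 2, 1, 2, 2], ![3, 3, 2, 3, 3], ![0, 1, -1, 0, 0]⟩ = 1 ∧
    ct ⟨1, fun _ => 1, fun _ => 2, ![0, -1, 0, 0, 0]⟩ = 0 := by decide

/-- THEOREM R⁺ on the examples: Zudilin `n = 1, 2` (`ct = +9, +469`, test passes, sign exponent even), the inner points
above (`ct = 3 = +ctAbs`, `ct = 1`; `ct = 0` with a failing test: `π₂ = 0`). -/
theorem ctAbs_examples : ctAbs ⟨2, fun _ => 2, fun _ => 4, fun _ => 0⟩ = 9 ∧ topPole ⟨2, fun _ => 2, fun _ => 4, fun _ => 0⟩ = true ∧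
    signExp ⟨2, fun _ => 2, fun _ => 4, fun _ => 0⟩ = 12 ∧ ctAbs ⟨3, fun _ => 3, fun _ => 6, fun _ => 0⟩ = 469 ∧
    ctAbs ⟨2, ![2, 1, 1, 1, 1], ![4, 3, 2, 2, 2], ![0, -1, -1, 0, 0]⟩ = 3 ∧
    topPole ⟨2, ![2, 1, 1, 1, 1], ![4, 3, 2, 2, 2], ![0, -1, -1, 0, 0]⟩ = true ∧
    topPole ⟨1, fun _ => 1, fun _ => 2, ![0, -1, 0, 0, 0]⟩ = false := by decide

/-- Depth 2/3 checks: Beukers `ζ(2)`, `n = 3`: `ct = -147`, `posChain = 147`, sign exponent `Σ(π_j-1)+Σγ_j = 6+3` odd; at depth 3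
with `B = γ = 3`, raising the middle pole order `π₂ = 7, 10, 11` gives `ct = 1445, -1, 0` and the test fails exactly at `11`
(`π₂ - 1 = 10 > B₂ + γ₁ + γ₂ = 9`). -/
theorem posChain_examples : ctChain [(3, 3, 4), (3, 0, 4)] 0 = -147 ∧ posChain [(3, 3, 4), (3, 0, 4)] 0 = 147 ∧
    posChain [(3, 3, 4), (3, 3, 7), (3, 0, 4)] 0 = 1445 ∧ topPoleTest [(3, 3, 4), (3, 3, 7), (3, 0, 4)] = true ∧
    topPoleTest [(3, 3, 4), (3, 3, 10), (3, 0, 4)] = true ∧ ctChain [(3, 3, 4), (3, 3, 10), (3, 0, 4)] 0 = -1 ∧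
    topPoleTest [(3, 3, 4), (3, 3, 11), (3, 0, 4)] = false ∧ ctChain [(3, 3, 4), (3, 3, 11), (3, 0, 4)] 0 = 0 := by decide

/-- **THEOREM R at depth 5** (top-coefficient / vertex-residue law; FAMILY §17n, THEOREM-R.md Thm 1.3 + Cor. 1.4).
PAPER STATUS: proved (elementary, THEOREM-R.md §2); kernel status: statement only.  For every admissible integrable
integer point of the generalized Sorokin family, `J(p) - 2·ct(p)·ζ(5) ∈ ℚ + ℚζ(2) + ℚζ(3) + ℚζ(4)`. -/
@[conjecture] def TopCoefficientLaw : Prop :=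
  ∀ p : GenPoint, p.Admissible → p.Integrable →
    ∃ q₀ q₂ q₃ q₄ : ℚ, p.J = q₀ + q₂ * (riemannZeta 2).re + q₃ * (riemannZeta 3).re + q₄ * (riemannZeta 4).re +
      2 * (p.ct : ℝ) * (riemannZeta 5).re

/-- **COROLLARY D** (FAMILY §8/§17n): on the whole convergent family `J(p) ∈ ℚ⟨1, ζ(2), ζ(3), ζ(4), ζ(5)⟩` —
no `ζ(2)ζ(3)`.  PAPER STATUS: corollary of THEOREM R (all multiple zeta values of weight ≤ 4 are rational
polynomials in `ζ(2), ζ(3)` of the displayed shape).  Census: `[ζ2ζ3] = 0` on 10,097,379 lane points + 17,220 exact points. -/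
@[conjecture] def NoZeta2Zeta3 : Prop :=
  ∀ p : GenPoint, p.Admissible → p.Integrable →
    ∃ q₀ q₂ q₃ q₄ q₅ : ℚ, p.J = q₀ + q₂ * (riemannZeta 2).re + q₃ * (riemannZeta 3).re + q₄ * (riemannZeta 4).re +
      q₅ * (riemannZeta 5).re

/-- COROLLARY D from THEOREM R (the only kernel content of the implication is bookkeeping). -/
theorem noZeta2Zeta3_of : TopCoefficientLaw → NoZeta2Zeta3 := by
  intro h p hp hi
  obtain ⟨q₀, q₂, q₃, q₄, hq⟩ := h p hp hi
  exact ⟨q₀, q₂, q₃, q₄, 2 * p.ct, by rw [hq]; push_cast; ring⟩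

/-- THEOREM R ⇒ the `'⟸'` half of the per-`n` TOP-pole law (FAMILY §17m(1)): where the constant term vanishes
(e.g. some `π_j ≤ 0`, or the monomial lies outside the Newton polytope), `ζ(5)` is absent. -/
theorem lowWeight_of_ct_eq_zero (h : TopCoefficientLaw) (p : GenPoint) (hp : p.Admissible) (hi : p.Integrable)
    (h0 : p.ct = 0) :
    ∃ q₀ q₂ q₃ q₄ : ℚ, p.J = q₀ + q₂ * (riemannZeta 2).re + q₃ * (riemannZeta 3).re + q₄ * (riemannZeta 4).re := by
  obtain ⟨q₀, q₂, q₃, q₄, hq⟩ := h p hp hi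
  exact ⟨q₀, q₂, q₃, q₄, by rw [hq, h0]; push_cast; ring⟩

/-- **THEOREM R⁺, sign law** (FAMILY §17n(7); THEOREM-R.md §1.8/§2.7): `ct(p) = (-1)^{Σ(π_j-1)+Σγ_j}·ctAbs(p)` — because
`P(-s) = (-1)^{Σγ} ∏(1+s_j)^{B_j}∏(1+s_j+s_{j+1})^{γ_j}` has non-negative coefficients.  PAPER STATUS: proved (one line); kernel:
statement + examples (a kernel proof is an induction over the chain, left to a prover). -/
@[conjecture] def CtSignLaw : Prop :=
  ∀ p : GenPoint, p.Admissible → p.topPole = true → p.ct = (-1) ^ p.signExp.toNat * (p.ctAbs : ℤ)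

/-- **THEOREM R⁺, non-vanishing criterion = the per-`n` TOP-POLE LAW of FAMILY §17m(1), both directions**
(THEOREM-R.md §1.8/§2.7): `ct(p) ≠ 0` iff the TOP-pole (supply–demand) test passes; with THEOREM R: `ζ(5)` occurs in `J(p)`
(coefficient `2·ct(p) ≠ 0`) iff every face of TOP carries a pole.  PAPER STATUS: proved (positivity of `P(-s)` + the
supply–demand theorem / max-flow–min-cut on the path network `B_j → {j}`, `γ_j → {j, j+1}`); kernel: statement + examples. -/
@[conjecture] def CtNeZeroIff : Prop :=
  ∀ p : GenPoint, p.Admissible → (p.ct ≠ 0 ↔ p.topPole = true)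

end GenPoint

/-- The depth-3 constant term for RAW natural parameters `(a₀; a₁,a₂,a₃ | b₁,b₂,b₃)` (`e₂ = 0`):
`π = (a₀, b₁ - 1, b₂ - c₃)`, `B_j = a_j - 1`, `γ_j = c_j - 1` (0-based arguments). -/
def ct3 (a₀ : ℕ) (a b : ℕ → ℕ) : ℤ :=
  ctChain [(a 0 - 1, b 0 - a 0 - 1, (a₀ : ℤ)), (a 1 - 1, b 1 - a 1 - 1, (b 0 : ℤ) - 1),
    (a 2 - 1, 0, (b 1 : ℤ) - ((b 2 - a 2 : ℕ) : ℤ))] 0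

/-- Beukers' diagonal again, through `ct3`. -/
theorem ct3_apery : ct3 2 (fun _ => 2) (fun _ => 4) = 5 ∧ ct3 3 (fun _ => 3) (fun _ => 6) = 73 := by decide

/-- **THEOREM R at depth 3** for the raw 7-parameter Beukers–Rhin–Viola-type family `J₃(a₀; a | b)` of
`Zudilin2002.sorokinIntegral 3`: `J₃ - 2·ct3·ζ(3) ∈ ℚ + ℚζ(2)` (`2ζ(3) = J₃(1;1³|2³)`, Beukers).  PAPER STATUS: proved
(THEOREM-R.md, same proof, `k = 3`); on the 6-parameter Rhin–Viola sub-family this is expected to be their contour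
formula (Acta Arith. 97 (2001), not verified here).  Kernel status: statement only. -/
@[conjecture] def TopCoefficientLaw3 : Prop :=
  ∀ (a₀ : ℕ) (a b : ℕ → ℕ), (∀ i < 3, 1 ≤ a i ∧ a i < b i) →
    IntegrableOn (sorokinIntegrand 3 (a₀ : ℝ) (fun j => (a j : ℝ)) (fun j => (b j : ℝ))) (cube 3) →
    ∃ q₀ q₂ : ℚ, sorokinIntegral 3 (a₀ : ℝ) (fun j => (a j : ℝ)) (fun j => (b j : ℝ)) =
      q₀ + q₂ * (riemannZeta 2).re + 2 * (ct3 a₀ a b : ℝ) * (riemannZeta 3).re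

end Summit.KontsevichZagierPeriods.Zeta5Search.SorokinCensus
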